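import Literature.Geometry.Kaehler.HypersurfaceExtension
import HarnessLib

/-!
# Holomorphic extension from a smooth hypersurface of a chart-convex open subset of a complex manifold

Transport of `exists_differentiableOn_forall_eq_of_local` (`HypersurfaceExtension.lean`: Cartan's
Theorem B in degree one for `0 → 𝒪 →ᵗ 𝒪 → 𝒪_Y → 0` over a convex domain) to the chart-convex
open subsets `W = chartSet 𝓘(ℝ, E) x₀ C` of a complex manifold — the finite intersections of the
nested Leray covers of the Cartan–Serre finiteness theorem — with the non-degeneracy of the
equation `t` expressed intrinsically through `mfderiv`:

* `mfderiv_eq_zero_iff_fderiv_comp_symm_eq_zero` — for `x` in the chart source at `x₀` and `t`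
  holomorphic near `x`, `mfderiv t x = 0 ↔ D(t ∘ φ⁻¹)(φ x) = 0` (`φ` the extended chart at `x₀`;
  chain rule with the invertible differential of the chart, `isInvertible_mfderiv_extChartAt`);
* `exists_mdifferentiableOn_forall_eq_of_local_chartSet` — if `t` is holomorphic on `W` with
  `mfderiv t ≠ 0` along `Y = {t = 0} ∩ W` and `f` is, near every point of `Y`, the restriction to
  `Y` of a holomorphic function, then ONE function holomorphic on `W` restricts to `f` on `Y`.

Everything is proved; theorems only.

## References

* K. Fritzsche, H. Grauert, *From Holomorphic Functions to Complex Manifolds*, GTM 213 (2002),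
  Ch. V §1 Prop. 1.6, §3. [FritzscheGrauert2002]
* C. Voisin, *Hodge Theory and Complex Algebraic Geometry I* (2002), §2.2.1. [VoisinHodgeI2002]
-/

noncomputable section

open scoped Manifold ContDiff Topology
open Set Filter

namespace Literature.Geometry.Kaehler

variable {E : Type*} [NormedAddCommGroup E] [NormedSpace ℂ E] [FiniteDimensional ℂ E]
  {M : Type*} [TopologicalSpace M] [ChartedSpace E M] [IsManifold 𝓘(ℂ, E) ω M]

omit [FiniteDimensional ℂ E] in
/-- **The differential read in a chart**: for `x` in the source of the extended chart `φ` at `x₀`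
and `t` whose chart representation `t ∘ φ.symm` is complex-differentiable at `φ x` (so that `t`
is complex-differentiable at `x`), `mfderiv t x = D(t ∘ φ.symm)(φ x) ∘ mfderiv φ x` (chain rule;
`φ.symm ∘ φ = id` near `x`). [folklore] -/
theorem mfderiv_eq_fderiv_comp_symm_comp (x₀ : M) {t : M → ℂ} {x : M}
    (hxs : x ∈ (extChartAt 𝓘(ℂ, E) x₀).source)
    (hts : DifferentiableAt ℂ (t ∘ (extChartAt 𝓘(ℂ, E) x₀).symm) (extChartAt 𝓘(ℂ, E) x₀ x)) :
    mfderiv 𝓘(ℂ, E) 𝓘(ℂ, ℂ) t x =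
      (fderiv ℂ (t ∘ (extChartAt 𝓘(ℂ, E) x₀).symm) (extChartAt 𝓘(ℂ, E) x₀ x)).comp
        (mfderiv 𝓘(ℂ, E) 𝓘(ℂ, E) (extChartAt 𝓘(ℂ, E) x₀) x) := by
  set φ := extChartAt 𝓘(ℂ, E) x₀ with hφ
  have hxs' : x ∈ (chartAt E x₀).source := by rwa [← extChartAt_source 𝓘(ℂ, E)]
  have h1 : HasMFDerivAt 𝓘(ℂ, E) 𝓘(ℂ, E) φ x (mfderiv 𝓘(ℂ, E) 𝓘(ℂ, E) φ x) :=
    (mdifferentiableAt_extChartAt hxs').hasMFDerivAt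
  have h2 : HasMFDerivAt 𝓘(ℂ, E) 𝓘(ℂ, ℂ) (t ∘ φ.symm) (φ x) (fderiv ℂ (t ∘ φ.symm) (φ x)) :=
    hasMFDerivAt_iff_hasFDerivAt.2 hts.hasFDerivAt
  have h3 := h2.comp x h1
  have hev : (t ∘ φ.symm) ∘ φ =ᶠ[𝓝 x] t := by
    filter_upwards [extChartAt_source_mem_nhds' hxs] with y hy
    simp only [Function.comp_apply, φ.left_inv hy]
  exact (h3.congr_of_eventuallyEq hev.symm).mfderiv

omit [FiniteDimensional ℂ E] in
/-- **Non-degeneracy is read in any chart**: for `x` in the chart source at `x₀` and `t` with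
chart representation complex-differentiable at `φ x`,
`mfderiv t x = 0 ↔ D(t ∘ φ.symm)(φ x) = 0` (the differential of the chart is invertible,
`isInvertible_mfderiv_extChartAt`). [folklore] -/
theorem mfderiv_eq_zero_iff_fderiv_comp_symm_eq_zero (x₀ : M) {t : M → ℂ} {x : M}
    (hxs : x ∈ (extChartAt 𝓘(ℂ, E) x₀).source)
    (hts : DifferentiableAt ℂ (t ∘ (extChartAt 𝓘(ℂ, E) x₀).symm) (extChartAt 𝓘(ℂ, E) x₀ x)) :
    mfderiv 𝓘(ℂ, E) 𝓘(ℂ, ℂ) t x = 0 ↔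
      fderiv ℂ (t ∘ (extChartAt 𝓘(ℂ, E) x₀).symm) (extChartAt 𝓘(ℂ, E) x₀ x) = 0 := by
  rw [mfderiv_eq_fderiv_comp_symm_comp x₀ hxs hts]
  obtain ⟨e, he⟩ := isInvertible_mfderiv_extChartAt (I := 𝓘(ℂ, E)) hxs
  set L := fderiv ℂ (t ∘ (extChartAt 𝓘(ℂ, E) x₀).symm) (extChartAt 𝓘(ℂ, E) x₀ x) with hL
  constructor
  · intro h
    ext v
    have h1 : L (mfderiv 𝓘(ℂ, E) 𝓘(ℂ, E) (extChartAt 𝓘(ℂ, E) x₀) x (e.symm v)) = 0 :=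
      ContinuousLinearMap.ext_iff.1 h (e.symm v)
    have h2 : mfderiv 𝓘(ℂ, E) 𝓘(ℂ, E) (extChartAt 𝓘(ℂ, E) x₀) x (e.symm v) = v := by
      rw [← he]; exact e.apply_symm_apply v
    rw [h2] at h1
    exact h1
  · intro h
    rw [h]
    ext v
    rfl

/-- **Holomorphic extension from a smooth hypersurface of a chart-convex open set** (Cartan's
Theorem B, degree one, transported through the holomorphic chart at `x₀`). Let
`W = chartSet 𝓘(ℝ, E) x₀ C` with `C` open convex in the chart target, `t` holomorphic on `W` with
`mfderiv t x ≠ 0` at every zero `x ∈ W`, and let `f : M → ℂ` agree near every point of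
`Y = {t = 0} ∩ W`, ON `Y`, with a holomorphic function. Then some `F` holomorphic on `W` satisfies
`F = f` on `Y`. [cite: FritzscheGrauert2002, Ch. V §1 Prop. 1.6 and §3] -/
theorem exists_mdifferentiableOn_forall_eq_of_local_chartSet (x₀ : M) {C : Set E} (hCo : IsOpen C)
    (hCc : Convex ℝ C) (hCT : C ⊆ (extChartAt 𝓘(ℝ, E) x₀).target) {t : M → ℂ}
    (ht : MDifferentiableOn 𝓘(ℂ, E) 𝓘(ℂ, ℂ) t (chartSet 𝓘(ℝ, E) x₀ C))
    (hdt : ∀ x ∈ chartSet 𝓘(ℝ, E) x₀ C, t x = 0 → mfderiv 𝓘(ℂ, E) 𝓘(ℂ, ℂ) t x ≠ 0) {f : M → ℂ}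
    (hf : ∀ y ∈ chartSet 𝓘(ℝ, E) x₀ C, t y = 0 → ∃ N : Set M, IsOpen N ∧ y ∈ N ∧
      N ⊆ chartSet 𝓘(ℝ, E) x₀ C ∧ ∃ F : M → ℂ, MDifferentiableOn 𝓘(ℂ, E) 𝓘(ℂ, ℂ) F N ∧
        ∀ z ∈ N, t z = 0 → F z = f z) :
    ∃ F : M → ℂ, MDifferentiableOn 𝓘(ℂ, E) 𝓘(ℂ, ℂ) F (chartSet 𝓘(ℝ, E) x₀ C) ∧
      ∀ z ∈ chartSet 𝓘(ℝ, E) x₀ C, t z = 0 → F z = f z := by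
  set φ := extChartAt 𝓘(ℂ, E) x₀ with hφ
  set W := chartSet 𝓘(ℝ, E) x₀ C with hW
  have hWo : IsOpen W := isOpen_chartSet 𝓘(ℝ, E) x₀ hCo
  have hWs : W ⊆ φ.source := chartSet_subset_source 𝓘(ℝ, E) x₀ C
  have hφW : ∀ x ∈ W, φ x ∈ C := fun x hx ↦ (mem_chartSet_iff.1 hx).2
  have hsymm : ∀ y ∈ C, φ.symm y ∈ W := fun y hy ↦ symm_mem_chartSet hCT hy
  -- the equation read in the chart
  set t' : E → ℂ := t ∘ φ.symm with ht'
  have ht'd : DifferentiableOn ℂ t' C :=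
    (differentiableOn_comp_extChartAt_symm_of_mdifferentiableOn ht hWo x₀).mono
      fun y hy ↦ ⟨hCT hy, hsymm y hy⟩
  have hdt' : ∀ y ∈ C, t' y = 0 → fderiv ℂ t' y ≠ 0 := fun y hy hty h0 ↦ by
    have hx : φ.symm y ∈ W := hsymm y hy
    have hxs : φ.symm y ∈ φ.source := hWs hx
    have hy' : φ (φ.symm y) = y := φ.right_inv (hCT hy)
    have hts : DifferentiableAt ℂ (t ∘ φ.symm) (φ (φ.symm y)) := by
      rw [hy']; exact ht'd.differentiableAt (hCo.mem_nhds hy)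
    refine hdt _ hx hty ((mfderiv_eq_zero_iff_fderiv_comp_symm_eq_zero x₀ hxs hts).2 ?_)
    rw [hy']
    exact h0
  -- the local extensions read in the chart
  have hf' : ∀ y ∈ C, t' y = 0 → ∃ N' : Set E, IsOpen N' ∧ y ∈ N' ∧ N' ⊆ C ∧
      ∃ F' : E → ℂ, DifferentiableOn ℂ F' N' ∧ ∀ z ∈ N', t' z = 0 → F' z = f (φ.symm z) := by
    intro y hy hty
    obtain ⟨N, hNo, hyN, hNW, F, hF, hFf⟩ := hf (φ.symm y) (hsymm y hy) hty
    refine ⟨φ.target ∩ φ.symm ⁻¹' N,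
      (continuousOn_extChartAt_symm x₀).isOpen_inter_preimage (isOpen_extChartAt_target x₀) hNo,
      ⟨hCT hy, hyN⟩, fun z hz ↦ ?_, F ∘ φ.symm,
      (differentiableOn_comp_extChartAt_symm_of_mdifferentiableOn hF hNo x₀), fun z hz htz ↦
        hFf _ hz.2 htz⟩
    have h1 := hφW _ (hNW hz.2)
    rwa [φ.right_inv hz.1] at h1
  obtain ⟨F', hF'd, hF'f⟩ := exists_differentiableOn_forall_eq_of_local hCo hCc ht'd hdt' hf'
  refine ⟨fun x ↦ F' (φ x), fun x hx ↦ ?_, fun z hz htz ↦ ?_⟩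
  · have hxs : x ∈ (chartAt E x₀).source := by
      rw [← extChartAt_source 𝓘(ℂ, E)]; exact hWs hx
    have h1 : MDifferentiableAt 𝓘(ℂ, E) 𝓘(ℂ, ℂ) F' (φ x) :=
      mdifferentiableAt_iff_differentiableAt.2 (hF'd.differentiableAt (hCo.mem_nhds (hφW x hx)))
    exact (h1.comp x (mdifferentiableAt_extChartAt hxs)).mdifferentiableWithinAt
  · have h1 := hF'f (φ z) (hφW z hz) (by simp only [ht', Function.comp_apply, φ.left_inv (hWs hz)]; exact htz)
    simp only [φ.left_inv (hWs hz)] at h1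
    exact h1

end Literature.Geometry.Kaehler
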